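import Mathlib
import HarnessLib
import Literature.Analysis.FluidPDE.TypeIAncientMild
import Summits.NavierStokesRegularity.NavierStokesRegularity.Theses.ExtremalTypeIConstant
import Summits.NavierStokesRegularity.NavierStokesRegularity.Theorems.ExtremalTypeIConstantSelfSimilarExcluded

/-!
# Crux `ExtremalSpiralSymmetry` (stmt-NavierStokesRegularity-8215), line `registered` — ROTATION IS FORCED:
# the spiral symmetry the crux predicts has nonzero rotation part

Support file (theorems only, `--supports stmt-NavierStokesRegularity-8215`; no definitions, no named facts). Lead c5.

The crux asserts that every extremal pair `(C, u)` of the KNSS-gauge Type-I ancient mild class carries a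
spiral-scaling generator `∇u·(a + x + Ax) + u + 2t ∂ₜu − Au ≡ 0` with `A` skew; `A = 0` is exact backward
self-similarity about `(−a, 0)`. The route's PROVED support item `SelfSimilarExcluded` (stmt-8219,
`extremalTypeIConstant_selfSimilarExcluded_proof`: Tsai 1998 Thm 1 at `q = ∞` in the Oseen gauge + KNSS Rem. 6.1) kills
every exactly self-similar element of the class. Hence, UNCONDITIONALLY:

* `spiralGenerator_rotation_ne_zero` — a NONTRIVIAL element of `A_C` annihilated by a spiral-scaling generator
  `(a, A)` has `A ≠ 0` (no skewness needed);
* `extremal_spiralGenerator_rotation_ne_zero` — the same for an extremal pair (`‖u(−1,0)‖ = C > 0` makes it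
  nontrivial);
* `extremalSpiralSymmetry_iff_rotating` — the crux is EQUIVALENT to its sharpened form in which the generator is
  required to ROTATE (`A ≠ 0`): the symmetry Conjecture M predicts for an extremal is necessarily a genuine Leray
  SPIRAL — a bounded-profile backward rotated-self-similar soliton with nonzero rotation rate — never a Leray
  self-similar profile. (For ideation / the disprover: the non-vacuous content of the crux lives entirely in the
  regime of crux 3 = stmt-8216 that print does not cover, Pineau–Vicol 2026 Thm 1.4 treating only decaying profiles
  at extreme rotation rates.)

Nothing here asserts the crux.
-/

noncomputable section

-- the summit and its single sub-problem share the name (CONVENTIONS §1), as in every Theorems file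
set_option linter.dupNamespace false

open Set MeasureTheory Filter Topology
open Literature.Analysis.FluidPDE

namespace Summit.NavierStokesRegularity.NavierStokesRegularity.Theorems.ExtremalSpiralSymmetry.Registered

open _root_.Summit.NavierStokesRegularity.NavierStokesRegularity.Theses.ExtremalTypeIConstant
open _root_.Summit.NavierStokesRegularity.NavierStokesRegularity.Theorems

/-- **Rotation is forced.** If a nontrivial element `u ∈ A_C` (some `u t x ≠ 0`, `t < 0`) is annihilated by the
spiral-scaling generator `∇u·(a + x + Ax) + u + 2t ∂ₜu − Au` of a pair `(a, A)`, then `A ≠ 0`: for `A = 0` the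
generator is the self-similar one about `(−a, 0)` and `SelfSimilarExcluded` (stmt-8219, proved) forces `u ≡ 0`.
[cite: Tsai1998, Thm 1 (q = ∞), via the landed `extremalTypeIConstant_selfSimilarExcluded_proof`] -/
theorem spiralGenerator_rotation_ne_zero {C : ℝ} {u : ℝ → EuclideanSpace ℝ (Fin 3) → EuclideanSpace ℝ (Fin 3)}
    (hu : IsTypeIAncientMild C u) (hne : ∃ t < 0, ∃ x, u t x ≠ 0)
    {a : EuclideanSpace ℝ (Fin 3)} {A : EuclideanSpace ℝ (Fin 3) →L[ℝ] EuclideanSpace ℝ (Fin 3)}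
    (hgen : ∀ t < 0, ∀ x, fderiv ℝ (u t) x (a + x + A x) + u t x +
      (2 * t) • Literature.Analysis.FluidPDE.timeDeriv u t x - A (u t x) = 0) :
    A ≠ 0 := by
  rintro rfl
  obtain ⟨t, ht, x, hx⟩ := hne
  apply hx
  refine extremalTypeIConstant_selfSimilarExcluded_proof C u (isTypeIAncientMild_iff.1 hu) ⟨a, ?_⟩ t ht x
  intro s hs y
  simpa only [zero_apply, add_zero, sub_zero] using hgen s hs y

/-- **Rotation is forced for extremal pairs.** An extremal pair `(C, u)` — `u ∈ A_C`, `‖u(−1,0)‖ = C > 0` — annihilated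
by the spiral-scaling generator of `(a, A)` has `A ≠ 0` (the hot spot makes `u` nontrivial). The minimality clause of
extremality is not used. [cite: Tsai1998, Thm 1 (q = ∞), via `SelfSimilarExcluded`] -/
theorem extremal_spiralGenerator_rotation_ne_zero {C : ℝ}
    {u : ℝ → EuclideanSpace ℝ (Fin 3) → EuclideanSpace ℝ (Fin 3)} (hC : 0 < C)
    (hu : ContDiffOn ℝ (⊤ : ℕ∞) (Function.uncurry u) (Set.Iio 0 ×ˢ Set.univ) ∧
      (∀ t < 0, Literature.Analysis.FluidPDE.VectorCalculus.IsDivFree (u t)) ∧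
      (∀ s t : ℝ, s < t → t < 0 → ∀ x, u t x =
        Literature.Analysis.FluidPDE.heatFlow (u s) (t - s) x -
          ∫ τ in Set.Ioo s t, ∫ y,
            Literature.Analysis.FluidPDE.oseenKernel (t - τ) (x - y) (u τ y) (u τ y)) ∧
      Literature.Analysis.FluidPDE.HasTypeITimeDecay C u)
    (hnorm : ‖u (-1) 0‖ = C)
    {a : EuclideanSpace ℝ (Fin 3)} {A : EuclideanSpace ℝ (Fin 3) →L[ℝ] EuclideanSpace ℝ (Fin 3)}
    (hgen : ∀ t < 0, ∀ x, fderiv ℝ (u t) x (a + x + A x) + u t x +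
      (2 * t) • Literature.Analysis.FluidPDE.timeDeriv u t x - A (u t x) = 0) :
    A ≠ 0 := by
  refine spiralGenerator_rotation_ne_zero (isTypeIAncientMild_iff.2 hu) ⟨-1, by norm_num, 0, fun h0 => ?_⟩ hgen
  rw [h0, norm_zero] at hnorm
  exact hC.ne' hnorm.symm

/-- **The crux is equivalent to its rotating form.** `ExtremalSpiralSymmetry` holds iff every extremal pair carries a
spiral-scaling generator `(a, A)` with `A` skew AND `A ≠ 0`. `←` forgets `A ≠ 0`; `→` is
`extremal_spiralGenerator_rotation_ne_zero`. UNCONDITIONAL. [cite: Tsai1998, Thm 1 (q = ∞), via `SelfSimilarExcluded`] -/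
theorem extremalSpiralSymmetry_iff_rotating :
    _root_.Summit.NavierStokesRegularity.NavierStokesRegularity.Theses.ExtremalTypeIConstant.ExtremalSpiralSymmetry ↔
      (∀ (C : ℝ) (u : ℝ → EuclideanSpace ℝ (Fin 3) → EuclideanSpace ℝ (Fin 3)), 0 < C →
        (ContDiffOn ℝ (⊤ : ℕ∞) (Function.uncurry u) (Set.Iio 0 ×ˢ Set.univ) ∧
            (∀ t < 0, Literature.Analysis.FluidPDE.VectorCalculus.IsDivFree (u t)) ∧
            (∀ s t : ℝ, s < t → t < 0 → ∀ x, u t x =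
              Literature.Analysis.FluidPDE.heatFlow (u s) (t - s) x -
                ∫ τ in Set.Ioo s t, ∫ y,
                  Literature.Analysis.FluidPDE.oseenKernel (t - τ) (x - y) (u τ y) (u τ y)) ∧
            Literature.Analysis.FluidPDE.HasTypeITimeDecay C u) ∧
          ‖u (-1) 0‖ = C ∧
          (∀ (C' : ℝ) (u' : ℝ → EuclideanSpace ℝ (Fin 3) → EuclideanSpace ℝ (Fin 3)),
            (ContDiffOn ℝ (⊤ : ℕ∞) (Function.uncurry u') (Set.Iio 0 ×ˢ Set.univ) ∧
              (∀ t < 0, Literature.Analysis.FluidPDE.VectorCalculus.IsDivFree (u' t)) ∧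
              (∀ s t : ℝ, s < t → t < 0 → ∀ x, u' t x =
                Literature.Analysis.FluidPDE.heatFlow (u' s) (t - s) x -
                  ∫ τ in Set.Ioo s t, ∫ y,
                    Literature.Analysis.FluidPDE.oseenKernel (t - τ) (x - y) (u' τ y) (u' τ y)) ∧
              Literature.Analysis.FluidPDE.HasTypeITimeDecay C' u') →
            (∃ t < 0, ∃ x, u' t x ≠ 0) → C ≤ C') →
        ∃ (a : EuclideanSpace ℝ (Fin 3)) (A : EuclideanSpace ℝ (Fin 3) →L[ℝ] EuclideanSpace ℝ (Fin 3)),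
          A ≠ 0 ∧ (∀ x, inner ℝ (A x) x = 0) ∧
            ∀ t < 0, ∀ x, fderiv ℝ (u t) x (a + x + A x) + u t x +
              (2 * t) • Literature.Analysis.FluidPDE.timeDeriv u t x - A (u t x) = 0) := by
  constructor
  · intro hESS C u hC hext
    obtain ⟨a, A, hA, hgen⟩ := hESS C u hC hext
    exact ⟨a, A, extremal_spiralGenerator_rotation_ne_zero hC hext.1 hext.2.1 hgen, hA, hgen⟩
  · intro h C u hC hext
    obtain ⟨a, A, -, hA, hgen⟩ := h C u hC hext
    exact ⟨a, A, hA, hgen⟩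

end Summit.NavierStokesRegularity.NavierStokesRegularity.Theorems.ExtremalSpiralSymmetry.Registered
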